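import Summits.ResolutionOfSingularities.ResolutionOfSingularities.Theorems.FrobeniusLadderFInjectiveMacaulayficationFiLocusOpenOfAffine
import Summits.ResolutionOfSingularities.ResolutionOfSingularities.Theorems.FrobeniusLadderFInjectiveMacaulayficationDegreeZeroDescent
import Mathlib.RingTheory.GradedAlgebra.Radical
import Mathlib.RingTheory.Localization.LocalizationLocalization
import Literature.RingTheory.TightClosure.CMFILocalizes
import HarnessLib

/-!
# Vertex ⇒ every prime: CMFI at the vertex of an ℕ-graded ring passes to all its primes (abstract Hashimoto bridge (α))
# (crux `FInjectiveMacaulayfication` stmt-ResolutionOfSingularities-15315, chain w45a, THEOREM-D / THEOREM-Q programme (A1); res-L1-w45a-idea-1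
# `ThmDSig.lean` r18.1 §3d `cmfiCl_of_vertex` (consumer shape); res-L1-w45a-plan-1 R16.8 (1) / R16.20 «stub-2: bridge `cmfiCl_of_vertex_of_hashimoto`»;
# named fact res-D-pv-019 AS stub-7 p567781 `Hashimoto2010_cmfi_of_homogeneousCore`; seat res-L1-w45a-stub-2)

[OURS · L1 W4.5a] Support file (`--supports stmt-ResolutionOfSingularities-15315 --as helper`); NOT a statement of any manuscript; CONDITIONAL results
(Hashimoto 2010 Cor. 5.2 as a SPELLED-OUT hypothesis `hH` — token-identical to the named fact `Hashimoto2010_cmfi_of_homogeneousCore` at universe 0,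
which is in the review queue — and Hashimoto 2010 Cor. 4.7 as the named fact `Literature.RingTheory.TightClosure.Hashimoto2010_cmfiLocalizes`,
file `CMFILocalizes.lean`); AI-written (AI review is weaker than expert review).

THE ABSTRACT BRIDGE `cmfi_atPrime_of_vertex (hH) (hL)`: let `A` be an `ℕ`-graded Noetherian ring of prime characteristic `p` and `𝔑` a MAXIMAL ideal
containing every proper homogeneous ideal (a «vertex»: e.g. `A₀` local and `𝔑 = 𝔪_{A₀} ⊕ A₊`). If `A_𝔑` is Cohen–Macaulay with Frobenius-closed parameter
ideals (CMFI, Hashimoto 2010 Lemma 4.1), then so is `A_𝔓` for EVERY prime `𝔓`. PROOF: the graded core `𝔓*` (Mathlib `Ideal.homogeneousCore`, prime) is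
a proper homogeneous ideal, so `𝔓* ≤ 𝔑`; `A_{𝔓*} = (A_𝔑)_{𝔓*}` is CMFI because CMFI LOCALIZES (Cor. 4.7, `hL`); then `A_𝔓` is CMFI by Cor. 5.2
(`hH`). This is the ring-theoretic content of §3d's `cmfiCl_of_vertex`; its instantiation to the associated graded ring `G(F)` of a filtration needs
the (separate, L-sized) `GradedRing` structure on `G(F)` — file (β).

Clauses are written INLINE in the token text of `SliceableCentre.CMCl` / `SliceableCentre.FCl` (which unfold to it), so that this file and the
Literature fact stay free of the route cone. [cite: Hashimoto2010, Cor. 4.7; Cor. 5.2; Lemma 4.1]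
-/

-- single-problem summit: the doubled namespace component is forced
set_option linter.dupNamespace false

noncomputable section

namespace Summit.ResolutionOfSingularities.ResolutionOfSingularities.Theorems.FInjectiveMacaulayfication.GradedVertexCMFI

open IsLocalRing RingTheory.Sequence
open Summit.ResolutionOfSingularities.ResolutionOfSingularities.Theorems.FInjectiveMacaulayfication

/-- The clause pair at `Localization.AtPrime` depends only on the prime ideal, not on the name of the ideal: transport along an equality of
ideals. [plumbing] -/
theorem clauses_atPrime_of_eq (p : ℕ) {A : Type} [CommRing A] {I J : Ideal A} [I.IsPrime] [J.IsPrime] (h : I = J)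
    (hc : (∀ d : ℕ, ringKrullDim (Localization.AtPrime I) = d →
        ∀ s : Fin d → Localization.AtPrime I, (Ideal.span (Set.range s)).radical.IsMaximal →
          IsWeaklyRegular (Localization.AtPrime I) (List.ofFn s)) ∧
      (∀ d : ℕ, ringKrullDim (Localization.AtPrime I) = d →
        ∀ s : Fin d → Localization.AtPrime I, (Ideal.span (Set.range s)).radical.IsMaximal →
          ∀ y : Localization.AtPrime I,
            (∃ e : ℕ, y ^ p ^ e ∈ Ideal.span ((fun z : Localization.AtPrime I => z ^ p ^ e) ''
              (Ideal.span (Set.range s) : Set (Localization.AtPrime I)))) →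
            y ∈ Ideal.span (Set.range s))) :
    (∀ d : ℕ, ringKrullDim (Localization.AtPrime J) = d →
        ∀ s : Fin d → Localization.AtPrime J, (Ideal.span (Set.range s)).radical.IsMaximal →
          IsWeaklyRegular (Localization.AtPrime J) (List.ofFn s)) ∧
      (∀ d : ℕ, ringKrullDim (Localization.AtPrime J) = d →
        ∀ s : Fin d → Localization.AtPrime J, (Ideal.span (Set.range s)).radical.IsMaximal →
          ∀ y : Localization.AtPrime J,
            (∃ e : ℕ, y ^ p ^ e ∈ Ideal.span ((fun z : Localization.AtPrime J => z ^ p ^ e) ''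
              (Ideal.span (Set.range s) : Set (Localization.AtPrime J)))) →
            y ∈ Ideal.span (Set.range s)) := by
  subst h
  exact hc

/-- **VERTEX ⇒ EVERY PRIME (abstract Hashimoto bridge).** `A` an `ℕ`-graded Noetherian ring of prime characteristic `p`; `𝔑` a maximal ideal
containing every proper homogeneous ideal; `A_𝔑` CMFI (CM clause ∧ F-clause). Then `A_𝔓` is CMFI for every prime `𝔓` — by CMFI-localization
(Hashimoto Cor. 4.7, `hL`) from `𝔑` to the graded core `𝔓* ≤ 𝔑`, then Hashimoto Cor. 5.2 (`hH`, the token text of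
`Literature.RingTheory.TightClosure.Hashimoto2010_cmfi_of_homogeneousCore` at universe `0`) from `𝔓*` to `𝔓`.
[OURS · conditional-result] [cite: Hashimoto2010, Cor. 4.7; Cor. 5.2] -/
theorem cmfi_atPrime_of_vertex
    (hH : ∀ (p : ℕ) [Fact p.Prime] (A : Type) [CommRing A] [IsNoetherianRing A] [CharP A p]
      (𝒜 : ℕ → AddSubgroup A) [GradedRing 𝒜] (P : Ideal A) [P.IsPrime] [(P.homogeneousCore 𝒜).toIdeal.IsPrime],
      ((∀ d : ℕ, ringKrullDim (Localization.AtPrime (P.homogeneousCore 𝒜).toIdeal) = d →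
          ∀ s : Fin d → Localization.AtPrime (P.homogeneousCore 𝒜).toIdeal, (Ideal.span (Set.range s)).radical.IsMaximal →
            RingTheory.Sequence.IsWeaklyRegular (Localization.AtPrime (P.homogeneousCore 𝒜).toIdeal) (List.ofFn s)) ∧
        (∀ d : ℕ, ringKrullDim (Localization.AtPrime (P.homogeneousCore 𝒜).toIdeal) = d →
          ∀ s : Fin d → Localization.AtPrime (P.homogeneousCore 𝒜).toIdeal, (Ideal.span (Set.range s)).radical.IsMaximal →
            ∀ y : Localization.AtPrime (P.homogeneousCore 𝒜).toIdeal,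
              (∃ e : ℕ, y ^ p ^ e ∈ Ideal.span ((fun z : Localization.AtPrime (P.homogeneousCore 𝒜).toIdeal => z ^ p ^ e) ''
                (Ideal.span (Set.range s) : Set (Localization.AtPrime (P.homogeneousCore 𝒜).toIdeal)))) →
              y ∈ Ideal.span (Set.range s))) →
      ((∀ d : ℕ, ringKrullDim (Localization.AtPrime P) = d →
          ∀ s : Fin d → Localization.AtPrime P, (Ideal.span (Set.range s)).radical.IsMaximal →
            RingTheory.Sequence.IsWeaklyRegular (Localization.AtPrime P) (List.ofFn s)) ∧
        (∀ d : ℕ, ringKrullDim (Localization.AtPrime P) = d →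
          ∀ s : Fin d → Localization.AtPrime P, (Ideal.span (Set.range s)).radical.IsMaximal →
            ∀ y : Localization.AtPrime P,
              (∃ e : ℕ, y ^ p ^ e ∈ Ideal.span ((fun z : Localization.AtPrime P => z ^ p ^ e) ''
                (Ideal.span (Set.range s) : Set (Localization.AtPrime P)))) →
              y ∈ Ideal.span (Set.range s))))
    (hL : Literature.RingTheory.TightClosure.Hashimoto2010_cmfiLocalizes.{0})
    (p : ℕ) [Fact p.Prime] {A : Type} [CommRing A] [IsNoetherianRing A] [CharP A p]
    (𝒜 : ℕ → AddSubgroup A) [GradedRing 𝒜] (𝔑 : Ideal A) [𝔑.IsMaximal]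
    (hvertex : ∀ I : Ideal A, I.IsHomogeneous 𝒜 → I ≠ ⊤ → I ≤ 𝔑)
    (h𝔑 : (∀ d : ℕ, ringKrullDim (Localization.AtPrime 𝔑) = d →
        ∀ s : Fin d → Localization.AtPrime 𝔑, (Ideal.span (Set.range s)).radical.IsMaximal →
          IsWeaklyRegular (Localization.AtPrime 𝔑) (List.ofFn s)) ∧
      (∀ d : ℕ, ringKrullDim (Localization.AtPrime 𝔑) = d →
        ∀ s : Fin d → Localization.AtPrime 𝔑, (Ideal.span (Set.range s)).radical.IsMaximal →
          ∀ y : Localization.AtPrime 𝔑,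
            (∃ e : ℕ, y ^ p ^ e ∈ Ideal.span ((fun z : Localization.AtPrime 𝔑 => z ^ p ^ e) ''
              (Ideal.span (Set.range s) : Set (Localization.AtPrime 𝔑)))) →
            y ∈ Ideal.span (Set.range s))) :
    ∀ (𝔓 : Ideal A) [𝔓.IsPrime],
      (∀ d : ℕ, ringKrullDim (Localization.AtPrime 𝔓) = d →
          ∀ s : Fin d → Localization.AtPrime 𝔓, (Ideal.span (Set.range s)).radical.IsMaximal →
            IsWeaklyRegular (Localization.AtPrime 𝔓) (List.ofFn s)) ∧
        (∀ d : ℕ, ringKrullDim (Localization.AtPrime 𝔓) = d →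
          ∀ s : Fin d → Localization.AtPrime 𝔓, (Ideal.span (Set.range s)).radical.IsMaximal →
            ∀ y : Localization.AtPrime 𝔓,
              (∃ e : ℕ, y ^ p ^ e ∈ Ideal.span ((fun z : Localization.AtPrime 𝔓 => z ^ p ^ e) ''
                (Ideal.span (Set.range s) : Set (Localization.AtPrime 𝔓)))) →
              y ∈ Ideal.span (Set.range s)) := by
  intro 𝔓 h𝔓
  haveI hcore : (𝔓.homogeneousCore 𝒜).toIdeal.IsPrime := h𝔓.homogeneousCore
  apply hH p A 𝒜 𝔓
  -- the graded core `𝔓* ≤ 𝔑`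
  set Q : Ideal A := (𝔓.homogeneousCore 𝒜).toIdeal with hQdef
  have hQ𝔑 : Q ≤ 𝔑 := hvertex Q (𝔓.homogeneousCore 𝒜).isHomogeneous hcore.ne_top
  -- `A_𝔑` is a Noetherian local ring of characteristic `p`; `Q·A_𝔑` is a prime of it
  haveI : CharP (Localization.AtPrime 𝔑) p := DegreeZeroDescent.charP_localization_atPrime p 𝔑
  have hdisj : Disjoint (𝔑.primeCompl : Set A) (Q : Set A) := by
    rw [Set.disjoint_left]
    intro x hx hxQ
    exact hx (hQ𝔑 hxQ)
  haveI hQ' : (Q.map (algebraMap A (Localization.AtPrime 𝔑))).IsPrime :=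
    IsLocalization.isPrime_of_isPrime_disjoint 𝔑.primeCompl _ Q hcore hdisj
  -- CMFI localizes: `(A_𝔑)_{Q A_𝔑}` is CMFI
  have h1 := hL p (Localization.AtPrime 𝔑) h𝔑 (Q.map (algebraMap A (Localization.AtPrime 𝔑)))
  -- `(A_𝔑)_{Q A_𝔑} ≅ A_Q`
  let e := (IsLocalization.localizationLocalizationAtPrimeIsoLocalization 𝔑.primeCompl
    (Q.map (algebraMap A (Localization.AtPrime 𝔑)))).symm.toRingEquiv
  have hunder : (Q.map (algebraMap A (Localization.AtPrime 𝔑))).comap (algebraMap A (Localization.AtPrime 𝔑)) = Q :=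
    IsLocalization.under_map_of_isPrime_disjoint 𝔑.primeCompl (Localization.AtPrime 𝔑) hcore hdisj
  exact clauses_atPrime_of_eq p hunder
    ⟨FiLocusOpenOfAffine.cmClause_of_ringEquiv e h1.1, FiLocusOpenOfAffine.fClause_of_ringEquiv p e h1.2⟩

end Summit.ResolutionOfSingularities.ResolutionOfSingularities.Theorems.FInjectiveMacaulayfication.GradedVertexCMFI

end
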